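import Mathlib
import Literature.Probability.Percolation.Percolation
import Literature.Probability.Percolation.DiagonalStripColumns
import Literature.Probability.Percolation.DiagonalColumnPatterns
import Literature.Probability.Percolation.DiagonalStripTransferLaw
import Literature.Probability.Percolation.DiagonalStripTransferExplicit
import Literature.Probability.Percolation.DiagonalStripStationary
import HarnessLib

/-!
# Planarity of the column patterns of the diagonal percolation strip (Ikhlef–Ponsaing, state space)

Topic `Literature/Probability/Percolation`. Part of the dictionary (step (i)) for the named fact
`Literature.Probability.Percolation.IkhlefPonsaingFirstPassage` (Ikhlef–Ponsaing, J. Stat. Phys.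
149 (2012), arXiv:1202.5476, §3.1): IP12's transfer matrix acts on LINK PATTERNS, i.e. planar
(non-crossing) pairings. In the cluster language of `DiagonalColumnPatterns.lean` the state of a
column is a pattern `P = (P.1, P.2)` (connectivity of the `m + 1` column sites to the left of the
column, wall contacts); this file proves that the column-transfer chain lives on PLANAR patterns:

* `IsPlanar P` — `P.1` is non-crossing (`i < j < k < l`, `i ~ k`, `j ~ l ⇒ i ~ j`) and wall
  contacts are never strictly nested in a foreign class (`i < j < k`, `i ~ k`, `j` flagged ⇒ `i ~ j`);
* generic part: `HasCrossing`, `WallNested`, `mergeRel`, `mergeList` and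
  **`not_hasCrossing_mergeRel`** / **`wallNested_mergeRel`** — merging the classes of two elements
  at CONSECUTIVE levels preserves non-crossing and wall nesting (the planar content of one lattice
  edge); `eqvGen_updRel_iff_mergeList` — the closure of the update relation is the iterated merge
  of the base relation along the open cross edges;
* **`colUpdate_isPlanar`** — for a valid planar input and a LATTICE edge layer (cross edges join
  consecutive levels `x₀ + x₁`), the updated pattern is planar; `colInit_isPlanar`,
  `colIter_isPlanar`;
* support: **`ipTransfer_eq_zero_of_not_isPlanar`** (from valid planar `P`, `T_c(P, ·)` is
  supported on planar patterns), `iterLaw_eq_zero_of_not_isPlanar`,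
  **`ipStationary_eq_zero_of_not_isPlanar`** — with `ipStationary_eq_zero_of_not_isValid`, the
  stationary law `π_m` lives on the valid planar even-column patterns (`binom(2m+1, m)` of them;
  merging the flagged classes lumps them onto the `C_{m+1} = |LP_{2m+1}|` link patterns of IP12 —
  the identification with `LP_L` itself is not done here).

## References

* Y. Ikhlef, A. K. Ponsaing, J. Stat. Phys. 149 (2012) 10–36, arXiv:1202.5476, §3.1 (link
  patterns, transfer matrix). [IkhlefPonsaing2012]
-/

namespace Literature.Probability.Percolation

open Literature.Probability.LatticeModels

/-! ### Generic: non-crossing equivalence relations on a levelled type; merging consecutive classes -/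

section Generic

open Relation

variable {V : Type*}

/-- A relation `S` **has a crossing** with respect to the levels `lv` if two `S`-related pairs
interleave (`p < q < r < s`, `p S r`, `q S s`) without being related to each other. A partition
of a linearly ordered set is *non-crossing* iff its relation has no crossing. [folklore] -/
def HasCrossing (lv : V → ℤ) (S : V → V → Prop) : Prop :=
  ∃ p q r s, lv p < lv q ∧ lv q < lv r ∧ lv r < lv s ∧ S p r ∧ S q s ∧ ¬ S p q

/-- **Wall nesting**: a flagged element strictly between two related elements is related to them
(flags = "joined to the wall below everything"; a wall connection cannot be strictly nested inside
another class without meeting it). [folklore] -/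
def WallNested (lv : V → ℤ) (S : V → V → Prop) (F : V → Prop) : Prop :=
  ∀ u z w, lv u < lv z → lv z < lv w → S u w → F z → S u z

/-- Merging the classes of `a` and `a'` in the relation `S`. [folklore] -/
def mergeRel (S : V → V → Prop) (a a' : V) : V → V → Prop :=
  fun x y => S x y ∨ (S x a ∧ S a' y) ∨ (S x a' ∧ S a y)

/-- Merging along a list of pairs. [folklore] -/
def mergeList (S : V → V → Prop) : List (V × V) → V → V → Prop
  | [] => S
  | e :: l => mergeRel (mergeList S l) e.1 e.2

variable {lv : V → ℤ} {S : V → V → Prop}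

/-- Reversing the order does not change crossings. [folklore] -/
theorem hasCrossing_neg (hS : Equivalence S) {l : V → ℤ} (h : HasCrossing (fun v => -l v) S) :
    HasCrossing l S := by
  obtain ⟨p, q, r, s, h1, h2, h3, hpr, hqs, hpq⟩ := h
  dsimp only at h1 h2 h3
  refine ⟨s, r, q, p, by omega, by omega, by omega, hS.symm hqs, hS.symm hpr, fun hsr => hpq ?_⟩
  exact hS.trans hpr (hS.trans (hS.symm hsr) (hS.symm hqs))

/-- Reversing the order does not change crossings (iff form). [folklore] -/
theorem hasCrossing_neg_iff (hS : Equivalence S) :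
    HasCrossing (fun v => -lv v) S ↔ HasCrossing lv S := by
  refine ⟨hasCrossing_neg hS, fun h => hasCrossing_neg hS ?_⟩
  simpa only [neg_neg] using h

/-- The `∀`-form of "no crossing". [folklore] -/
theorem rel_of_not_hasCrossing (hnc : ¬ HasCrossing lv S) {p q r s : V} (h1 : lv p < lv q)
    (h2 : lv q < lv r) (h3 : lv r < lv s) (hpr : S p r) (hqs : S q s) : S p q := by
  by_contra hpq
  exact hnc ⟨p, q, r, s, h1, h2, h3, hpr, hqs, hpq⟩

/-- `mergeRel` is symmetric in the two merged elements. [folklore] -/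
theorem mergeRel_comm (S : V → V → Prop) (a a' : V) : mergeRel S a a' = mergeRel S a' a := by
  funext x y
  apply propext
  unfold mergeRel
  tauto

/-- Merging two elements of the same class does nothing. [folklore] -/
theorem mergeRel_eq_of_rel (hS : Equivalence S) {a a' : V} (h : S a a') : mergeRel S a a' = S := by
  funext x y
  apply propext
  refine ⟨?_, Or.inl⟩
  rintro (hxy | ⟨hxa, hay⟩ | ⟨hxa, hay⟩)
  · exact hxy
  · exact hS.trans hxa (hS.trans h hay)
  · exact hS.trans hxa (hS.trans (hS.symm h) hay)

/-- `S ≤ mergeRel S a a'`. [folklore] -/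
theorem mergeRel_of_rel {a a' x y : V} (h : S x y) : mergeRel S a a' x y := Or.inl h

/-- The merged elements are related. [folklore] -/
theorem mergeRel_self (hS : Equivalence S) (a a' : V) : mergeRel S a a' a a' :=
  Or.inr (Or.inl ⟨hS.refl a, hS.refl a'⟩)

/-- Merging two classes of an equivalence relation gives an equivalence relation. [folklore] -/
theorem mergeRel_equivalence (hS : Equivalence S) (a a' : V) : Equivalence (mergeRel S a a') := by
  by_cases h : S a a'
  · rw [mergeRel_eq_of_rel hS h]; exact hS
  refine ⟨fun x => Or.inl (hS.refl x), ?_, ?_⟩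
  · rintro x y (hxy | ⟨hxa, hay⟩ | ⟨hxa, hay⟩)
    · exact Or.inl (hS.symm hxy)
    · exact Or.inr (Or.inr ⟨hS.symm hay, hS.symm hxa⟩)
    · exact Or.inr (Or.inl ⟨hS.symm hay, hS.symm hxa⟩)
  · rintro x y z (hxy | ⟨hxa, hay⟩ | ⟨hxa, hay⟩) (hyz | ⟨hya, haz⟩ | ⟨hya, haz⟩)
    · exact Or.inl (hS.trans hxy hyz)
    · exact Or.inr (Or.inl ⟨hS.trans hxy hya, haz⟩)
    · exact Or.inr (Or.inr ⟨hS.trans hxy hya, haz⟩)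
    · exact Or.inr (Or.inl ⟨hxa, hS.trans hay hyz⟩)
    · exact absurd (hS.symm (hS.trans hay hya)) h
    · exact Or.inl (hS.trans hxa haz)
    · exact Or.inr (Or.inr ⟨hxa, hS.trans hay hyz⟩)
    · exact Or.inl (hS.trans hxa haz)
    · exact absurd (hS.trans hay hya) h

/-- `mergeList S l` is an equivalence relation. [folklore] -/
theorem mergeList_equivalence (hS : Equivalence S) : ∀ l : List (V × V), Equivalence (mergeList S l)
  | [] => hS
  | _ :: l => mergeRel_equivalence (mergeList_equivalence hS l) _ _

/-- `S ≤ mergeList S l`. [folklore] -/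
theorem mergeList_of_rel {x y : V} (h : S x y) : ∀ l : List (V × V), mergeList S l x y
  | [] => h
  | _ :: l => mergeRel_of_rel (mergeList_of_rel h l)

/-- Every pair of the list is related in `mergeList S l`. [folklore] -/
theorem mergeList_of_mem (hS : Equivalence S) :
    ∀ (l : List (V × V)) {e : V × V}, e ∈ l → mergeList S l e.1 e.2
  | [], _, h => absurd h List.not_mem_nil
  | e' :: l, e, h => by
    rcases List.mem_cons.1 h with rfl | h
    · exact mergeRel_self (mergeList_equivalence hS l) _ _
    · exact mergeRel_of_rel (mergeList_of_mem hS l h)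

/-- `mergeList S l` is below every equivalence relation containing `S` and the pairs of `l`; in
particular below `EqvGen r` when `S ≤ EqvGen r` and the pairs are `r`-related. [folklore] -/
theorem mergeList_le_eqvGen {r : V → V → Prop} (hSr : ∀ x y, S x y → EqvGen r x y) :
    ∀ (l : List (V × V)), (∀ e ∈ l, EqvGen r e.1 e.2) → ∀ x y, mergeList S l x y → EqvGen r x y
  | [], _, x, y, h => hSr x y h
  | e :: l, hl, x, y, h => by
    have ih := mergeList_le_eqvGen hSr l (fun e' he' => hl e' (List.mem_cons_of_mem _ he'))
    have he := hl e List.mem_cons_self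
    rcases h with h | ⟨h1, h2⟩ | ⟨h1, h2⟩
    · exact ih x y h
    · exact (ih _ _ h1).trans _ _ _ (he.trans _ _ _ (ih _ _ h2))
    · exact (ih _ _ h1).trans _ _ _ ((he.symm _ _).trans _ _ _ (ih _ _ h2))

/-- Conversely `EqvGen r ≤ mergeList S l` as soon as `r ≤ mergeList S l` (an equivalence
relation). [folklore] -/
theorem eqvGen_le_mergeList (hS : Equivalence S) {r : V → V → Prop} (l : List (V × V))
    (hr : ∀ x y, r x y → mergeList S l x y) {x y : V} (h : EqvGen r x y) : mergeList S l x y :=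
  (mergeList_equivalence hS l).eqvGen_iff.1 (EqvGen.mono hr x y h)

/-- The core case analysis: if `S` has no crossing, a class avoiding two *consecutive* elements
`a, a'` cannot interleave with the union of their classes. [folklore] -/
private theorem mergeRel_aux (hS : Equivalence S) (hlv : Function.Injective lv)
    (hnc : ¬ HasCrossing lv S) {a a' : V} (ha : lv a' = lv a + 1) {p q r s : V}
    (h1 : lv p < lv q) (h2 : lv q < lv r) (h3 : lv r < lv s)
    (hq : ¬ S q a) (hq' : ¬ S q a') (hqs : S q s)
    (hpr : (S p a ∧ S r a') ∨ (S p a' ∧ S r a)) : False := by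
  have nc : ∀ {p q r s : V}, lv p < lv q → lv q < lv r → lv r < lv s → S p r → S q s → S p q :=
    fun h1 h2 h3 hpr hqs => rel_of_not_hasCrossing hnc h1 h2 h3 hpr hqs
  have hne : ∀ {x y : V}, ¬ S x y → lv x ≠ lv y := fun h heq => h (by rw [hlv heq]; exact hS.refl _)
  have hsa : ¬ S s a := fun h => hq (hS.trans hqs h)
  have hsa' : ¬ S s a' := fun h => hq' (hS.trans hqs h)
  have hqa := hne hq
  have hqa' := hne hq'
  have hsa₁ := hne hsa
  have hsa'₁ := hne hsa'
  rcases hpr with ⟨hpa, hra'⟩ | ⟨hpa', hra⟩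
  · rcases lt_or_gt_of_ne hqa with hlt | hgt
    · rcases lt_or_gt_of_ne hsa₁ with hs | hs
      · -- q < r < s < a < a' : crossing of Z = [q] and A' = [r]
        exact hq' (hS.trans (nc h2 h3 (by omega) hqs hra') hra')
      · -- p < q < a < s : crossing of A = [p] and Z = [q]
        exact hq (hS.trans (hS.symm (nc h1 hlt hs hpa hqs)) hpa)
    · -- a' < q < r < s : crossing of A' = [a'] ∋ r and Z = [q]
      exact hq' (hS.symm (nc (by omega) h2 h3 (hS.symm hra') hqs))
  · rcases lt_or_gt_of_ne hqa with hlt | hgt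
    · rcases lt_or_gt_of_ne hsa'₁ with hs | hs
      · -- q < r < s < a : crossing of Z and A = [r]
        exact hq (hS.trans (nc h2 h3 (by omega) hqs hra) hra)
      · -- p < q < a' < s : crossing of A' = [p] and Z
        exact hq' (hS.trans (hS.symm (nc h1 (by omega) hs hpa' hqs)) hpa')
    · -- a < q < r < s : crossing of A = [a] ∋ r and Z
      exact hq (hS.symm (nc hgt h2 h3 (hS.symm hra) hqs))

/-- **Merging two consecutive elements preserves non-crossing.** [folklore] -/
theorem not_hasCrossing_mergeRel (hS : Equivalence S) (hlv : Function.Injective lv)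
    (hnc : ¬ HasCrossing lv S) {a a' : V} (ha : lv a' = lv a + 1) :
    ¬ HasCrossing lv (mergeRel S a a') := by
  by_cases hna : S a a'
  · rwa [mergeRel_eq_of_rel hS hna]
  have hlv' : Function.Injective fun v => -lv v := fun x y h => hlv (neg_injective h)
  have hnc' : ¬ HasCrossing (fun v => -lv v) S := fun h => hnc (hasCrossing_neg hS h)
  rintro ⟨p, q, r, s, h1, h2, h3, hpr, hqs, hpq⟩
  simp only [mergeRel, not_or, not_and] at hpq
  obtain ⟨hpq, hpq₁, hpq₂⟩ := hpq
  rcases hpr with hpr | ⟨hpa, har⟩ | ⟨hpa, har⟩ <;> rcases hqs with hqs | ⟨hqa, has⟩ | ⟨hqa, has⟩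
  · exact hpq (rel_of_not_hasCrossing hnc h1 h2 h3 hpr hqs)
  · -- Z = [p] ∋ r ; q ∈ A, s ∈ A' : reversed picture
    have hra : ¬ S r a := fun h => hpq (hS.trans (hS.trans hpr h) (hS.symm hqa))
    have hra' : ¬ S r a' := fun h => hpq₂ (hS.trans hpr h) (hS.symm hqa)
    exact mergeRel_aux (lv := fun v => -lv v) hS hlv' hnc' (a := a') (a' := a)
      (show -lv a = -lv a' + 1 by omega) (p := s) (q := r) (r := q) (s := p)
      (show -lv s < -lv r by omega) (show -lv r < -lv q by omega) (show -lv q < -lv p by omega)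
      hra' hra (hS.symm hpr) (Or.inl ⟨hS.symm has, hqa⟩)
  · have hra' : ¬ S r a' := fun h => hpq (hS.trans (hS.trans hpr h) (hS.symm hqa))
    have hra : ¬ S r a := fun h => hpq₁ (hS.trans hpr h) (hS.symm hqa)
    exact mergeRel_aux (lv := fun v => -lv v) hS hlv' hnc' (a := a') (a' := a)
      (show -lv a = -lv a' + 1 by omega) (p := s) (q := r) (r := q) (s := p)
      (show -lv s < -lv r by omega) (show -lv r < -lv q by omega) (show -lv q < -lv p by omega)
      hra' hra (hS.symm hpr) (Or.inr ⟨hS.symm has, hqa⟩)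
  · -- p ∈ A, r ∈ A' ; Z = [q] ∋ s
    have hqa : ¬ S q a := fun h => hpq (hS.trans hpa (hS.symm h))
    have hqa' : ¬ S q a' := fun h => hpq₁ hpa (hS.symm h)
    exact mergeRel_aux hS hlv hnc ha h1 h2 h3 hqa hqa' hqs (Or.inl ⟨hpa, hS.symm har⟩)
  · exact hpq (hS.trans hpa (hS.symm hqa))
  · exact hpq₁ hpa (hS.symm hqa)
  · have hqa' : ¬ S q a' := fun h => hpq (hS.trans hpa (hS.symm h))
    have hqa : ¬ S q a := fun h => hpq₂ hpa (hS.symm h)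
    exact mergeRel_aux hS hlv hnc ha h1 h2 h3 hqa hqa' hqs (Or.inr ⟨hpa, hS.symm har⟩)
  · exact hpq₂ hpa (hS.symm hqa)
  · exact hpq (hS.trans hpa (hS.symm hqa))

/-- **Merging two consecutive elements preserves wall nesting.** [folklore] -/
theorem wallNested_mergeRel (hS : Equivalence S) (hlv : Function.Injective lv) {F : V → Prop}
    (hW : WallNested lv S F) {a a' : V} (ha : lv a' = lv a + 1) :
    WallNested lv (mergeRel S a a') F := by
  by_cases hna : S a a'
  · rwa [mergeRel_eq_of_rel hS hna]
  have hne : ∀ {x y : V}, ¬ S x y → lv x ≠ lv y := fun h heq => h (by rw [hlv heq]; exact hS.refl _)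
  intro u z w h1 h2 huw hz
  by_cases hzu : S u z
  · exact Or.inl hzu
  rcases huw with huw | ⟨hua, haw⟩ | ⟨hua, haw⟩
  · exact absurd (hW u z w h1 h2 huw hz) hzu
  · by_cases hza' : S z a'
    · exact Or.inr (Or.inl ⟨hua, hS.symm hza'⟩)
    exfalso
    have hza : ¬ S z a := fun h => hzu (hS.trans hua (hS.symm h))
    rcases lt_or_gt_of_ne (hne hza) with hlt | hgt
    · exact hzu (hW u z a h1 hlt hua hz)
    · have : lv a' < lv z := by have := hne hza'; omega
      exact hza' (hS.symm (hW a' z w this h2 haw hz))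
  · by_cases hza : S z a
    · exact Or.inr (Or.inr ⟨hua, hS.symm hza⟩)
    exfalso
    have hza' : ¬ S z a' := fun h => hzu (hS.trans hua (hS.symm h))
    rcases lt_or_gt_of_ne (hne hza') with hlt | hgt
    · exact hzu (hW u z a' h1 hlt hua hz)
    · exact hza (hS.symm (hW a z w (by omega) h2 haw hz))

/-- Merging along a list of consecutive pairs preserves non-crossing. [folklore] -/
theorem not_hasCrossing_mergeList (hS : Equivalence S) (hlv : Function.Injective lv)
    (hnc : ¬ HasCrossing lv S) :
    ∀ (l : List (V × V)), (∀ e ∈ l, lv e.2 = lv e.1 + 1 ∨ lv e.1 = lv e.2 + 1) →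
      ¬ HasCrossing lv (mergeList S l)
  | [], _ => hnc
  | e :: l, hl => by
    have ih := not_hasCrossing_mergeList hS hlv hnc l fun e' he' => hl e' (List.mem_cons_of_mem _ he')
    have hSl := mergeList_equivalence hS l
    rcases hl e List.mem_cons_self with he | he
    · exact not_hasCrossing_mergeRel hSl hlv ih he
    · show ¬ HasCrossing lv (mergeRel (mergeList S l) e.1 e.2)
      rw [mergeRel_comm]
      exact not_hasCrossing_mergeRel hSl hlv ih he

/-- Merging along a list of consecutive pairs preserves wall nesting. [folklore] -/
theorem wallNested_mergeList (hS : Equivalence S) (hlv : Function.Injective lv) {F : V → Prop}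
    (hW : WallNested lv S F) :
    ∀ (l : List (V × V)), (∀ e ∈ l, lv e.2 = lv e.1 + 1 ∨ lv e.1 = lv e.2 + 1) →
      WallNested lv (mergeList S l) F
  | [], _ => hW
  | e :: l, hl => by
    have ih := wallNested_mergeList hS hlv hW l fun e' he' => hl e' (List.mem_cons_of_mem _ he')
    have hSl := mergeList_equivalence hS l
    rcases hl e List.mem_cons_self with he | he
    · exact wallNested_mergeRel hSl hlv ih he
    · show WallNested lv (mergeRel (mergeList S l) e.1 e.2) F
      rw [mergeRel_comm]
      exact wallNested_mergeRel hSl hlv ih he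

end Generic

/-! ### Planar column patterns; the update preserves planarity -/

section Planar

variable {m : ℕ}

/-- **Planar column patterns**: the partition `P.1` of the column sites is non-crossing, and a
site joined to the wall is never strictly nested inside a class it does not belong to (IP12's link
patterns are planar pairings; here in the cluster language). [cite: IkhlefPonsaing2012, §3.1] -/
structure IsPlanar (P : ColPattern m) : Prop where
  noncross : ∀ i j k l : Fin (m + 1), i < j → j < k → k < l →
    P.1 i k = true → P.1 j l = true → P.1 i j = true
  wall_nested : ∀ i j k : Fin (m + 1), i < j → j < k → P.1 i k = true → P.2 j = true → P.1 i j = true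

/-- The levels `x₀ + x₁` of the old (`inl`, column `c`) and new (`inr`, column `c + 1`) sites:
`2i + c % 2` and `2j + 1 - c % 2`. [folklore] -/
def colLv (m : ℕ) (c : ℤ) : Fin (m + 1) ⊕ Fin (m + 1) → ℤ
  | Sum.inl i => 2 * (i : ℕ) + c % 2
  | Sum.inr j => 2 * (j : ℕ) + 1 - c % 2

/-- The levels separate the sites. [folklore] -/
theorem colLv_injective (m : ℕ) (c : ℤ) : Function.Injective (colLv m c) := by
  have hc := Int.emod_two_eq_zero_or_one c
  rintro (i | j) (i' | j') h <;> simp only [colLv] at h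
  · exact congrArg Sum.inl (Fin.ext (by omega))
  · omega
  · omega
  · exact congrArg Sum.inr (Fin.ext (by omega))

/-- The base relation of the update: the old pattern on old sites, equality on new sites. [folklore] -/
def colBase (P : ColPattern m) : Fin (m + 1) ⊕ Fin (m + 1) → Fin (m + 1) ⊕ Fin (m + 1) → Prop
  | Sum.inl i, Sum.inl i' => P.1 i i' = true
  | Sum.inr j, Sum.inr j' => j = j'
  | Sum.inl _, Sum.inr _ => False
  | Sum.inr _, Sum.inl _ => False

/-- For a valid pattern the base relation is an equivalence relation. [folklore] -/
theorem colBase_equivalence {c : ℤ} {P : ColPattern m} (hP : IsValid c P) :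
    Equivalence (colBase P) := by
  refine ⟨?_, ?_, ?_⟩
  · rintro (i | j)
    · exact hP.refl i
    · exact rfl
  · rintro (i | j) (i' | j') h <;> simp only [colBase] at h ⊢
    · exact hP.symm _ _ h
    · exact h.symm
  · rintro (i | j) (i' | j') (i'' | j'') h h' <;> simp only [colBase] at h h' ⊢
    · exact hP.trans _ _ _ h h'
    · exact h.trans h'

/-- The cross pairs of an edge layer, as a list. [folklore] -/
noncomputable def colEdgeList (E : Fin (m + 1) → Fin (m + 1) → Bool) :
    List ((Fin (m + 1) ⊕ Fin (m + 1)) × (Fin (m + 1) ⊕ Fin (m + 1))) :=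
  ((Finset.univ.filter fun e : Fin (m + 1) × Fin (m + 1) => E e.1 e.2 = true).toList.map
    fun e => (Sum.inl e.1, Sum.inr e.2))

/-- Membership in the list of cross pairs. [folklore] -/
theorem mem_colEdgeList_iff {E : Fin (m + 1) → Fin (m + 1) → Bool}
    {e : (Fin (m + 1) ⊕ Fin (m + 1)) × (Fin (m + 1) ⊕ Fin (m + 1))} :
    e ∈ colEdgeList E ↔ ∃ i j, E i j = true ∧ e = (Sum.inl i, Sum.inr j) := by
  simp only [colEdgeList, List.mem_map, Finset.mem_toList, Finset.mem_filter, Finset.mem_univ,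
    true_and, Prod.exists]
  constructor
  · rintro ⟨i, j, h, rfl⟩
    exact ⟨i, j, h, rfl⟩
  · rintro ⟨i, j, h, rfl⟩
    exact ⟨i, j, h, rfl⟩

/-- **The closure of the update relation is the iterated merge** of the base relation along the
cross pairs. [folklore] -/
theorem eqvGen_updRel_iff_mergeList {c : ℤ} {P : ColPattern m} (hP : IsValid c P)
    (E : Fin (m + 1) → Fin (m + 1) → Bool) (x y : Fin (m + 1) ⊕ Fin (m + 1)) :
    Relation.EqvGen (updRel m P E) x y ↔ mergeList (colBase P) (colEdgeList E) x y := by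
  have hS := colBase_equivalence hP
  constructor
  · refine eqvGen_le_mergeList hS _ ?_
    rintro (i | j) (i' | j') h <;> simp only [updRel] at h
    · exact mergeList_of_rel (show colBase P (Sum.inl i) (Sum.inl i') from h) _
    · exact mergeList_of_mem hS _ (e := (Sum.inl i, Sum.inr j'))
        (mem_colEdgeList_iff.2 ⟨i, j', h, rfl⟩)
    · exact (mergeList_equivalence hS _).symm
        (mergeList_of_mem hS _ (e := (Sum.inl i', Sum.inr j)) (mem_colEdgeList_iff.2 ⟨i', j, h, rfl⟩))
  · refine mergeList_le_eqvGen ?_ _ ?_ x y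
    · rintro (i | j) (i' | j') h <;> simp only [colBase] at h
      · exact Relation.EqvGen.rel _ _ h
      · exact h ▸ Relation.EqvGen.refl _
    · intro e he
      obtain ⟨i, j, h, rfl⟩ := mem_colEdgeList_iff.1 he
      exact Relation.EqvGen.rel _ _ h

/-- A planar pattern gives a base relation without crossing. [folklore] -/
theorem not_hasCrossing_colBase (c : ℤ) {P : ColPattern m} (hPl : IsPlanar P) :
    ¬ HasCrossing (colLv m c) (colBase P) := by
  rintro ⟨p, q, r, s, h1, h2, h3, hpr, hqs, hpq⟩
  rcases p with ip | jp <;> rcases r with ir | jr <;> simp only [colBase] at hpr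
  · rcases q with iq | jq <;> rcases s with is | js <;> simp only [colBase] at hqs
    · simp only [colLv] at h1 h2 h3
      refine hpq (hPl.noncross ip iq ir is ?_ ?_ ?_ hpr hqs) <;>
        exact Fin.lt_def.2 (by omega)
    · subst hqs
      simp only [colLv] at h2 h3
      omega
  · subst hpr
    simp only [colLv] at h1 h2
    omega

/-- A planar pattern gives a wall-nested base relation (flags = the update's wall contacts). [folklore] -/
theorem wallNested_colBase (c : ℤ) {P : ColPattern m} (hPl : IsPlanar P) :
    WallNested (colLv m c) (colBase P) (updWall m c P) := by
  have hc := Int.emod_two_eq_zero_or_one c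
  intro u z w h1 h2 huw hz
  rcases u with iu | ju <;> rcases w with iw | jw <;> simp only [colBase] at huw
  · rcases z with iz | jz <;> simp only [updWall] at hz
    · simp only [colLv] at h1 h2
      exact hPl.wall_nested iu iz iw (Fin.lt_def.2 (by omega))
        (Fin.lt_def.2 (by omega)) huw hz
    · simp only [colLv] at h1
      omega
  · subst huw
    omega

/-- The cross pairs of a *lattice* edge layer join consecutive levels. [folklore] -/
theorem colLv_consecutive_of_adj (c : ℤ) {E : Fin (m + 1) → Fin (m + 1) → Bool}
    (hE : ∀ i j, E i j = true → (zdGraph 2).Adj (colSite c i) (colSite (c + 1) j)) :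
    ∀ e ∈ colEdgeList E, colLv m c e.2 = colLv m c e.1 + 1 ∨ colLv m c e.1 = colLv m c e.2 + 1 := by
  have hc := Int.emod_two_eq_zero_or_one c
  intro e he
  obtain ⟨i, j, h, rfl⟩ := mem_colEdgeList_iff.1 he
  have := (adj_colSite_colSite_succ_iff c i j).1 (hE i j h)
  simp only [colLv]
  omega

/-- **The update preserves planarity** (for lattice edge layers and valid planar inputs): the
closure of the update relation is an iterated merge of consecutive levels, which preserves
non-crossing and wall nesting. [cite: IkhlefPonsaing2012, §3.1] -/
theorem colUpdate_isPlanar {c : ℤ} {P : ColPattern m} (hP : IsValid c P) (hPl : IsPlanar P)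
    {E : Fin (m + 1) → Fin (m + 1) → Bool}
    (hE : ∀ i j, E i j = true → (zdGraph 2).Adj (colSite c i) (colSite (c + 1) j)) :
    IsPlanar (colUpdate m c P E) := by
  classical
  have hc := Int.emod_two_eq_zero_or_one c
  set R : Fin (m + 1) ⊕ Fin (m + 1) → Fin (m + 1) ⊕ Fin (m + 1) → Prop :=
    Relation.EqvGen (updRel m P E) with hRdef
  have hR : Equivalence R := Relation.EqvGen.is_equivalence _
  have hRM : R = mergeList (colBase P) (colEdgeList E) := by
    funext x y
    exact propext (eqvGen_updRel_iff_mergeList hP E x y)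
  have hS := colBase_equivalence hP
  have hcons := colLv_consecutive_of_adj c hE
  have hNC : ¬ HasCrossing (colLv m c) R := by
    rw [hRM]
    exact not_hasCrossing_mergeList hS (colLv_injective m c) (not_hasCrossing_colBase c hPl) _ hcons
  have hWN : WallNested (colLv m c) R (updWall m c P) := by
    rw [hRM]
    exact wallNested_mergeList hS (colLv_injective m c) (wallNested_colBase c hPl) _ hcons
  have nc : ∀ {p q r s}, colLv m c p < colLv m c q → colLv m c q < colLv m c r →
      colLv m c r < colLv m c s → R p r → R q s → R p q :=
    fun h1 h2 h3 hpr hqs => rel_of_not_hasCrossing hNC h1 h2 h3 hpr hqs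
  refine ⟨fun i j k l hij hjk hkl hik hjl => ?_, fun i j k hij hjk hik hj => ?_⟩
  · simp only [colUpdate, decide_eq_true_eq] at hik hjl ⊢
    have hij' := Fin.lt_def.1 hij
    have hjk' := Fin.lt_def.1 hjk
    have hkl' := Fin.lt_def.1 hkl
    exact nc (by simp only [colLv]; omega) (by simp only [colLv]; omega)
      (by simp only [colLv]; omega) hik hjl
  · simp only [colUpdate, decide_eq_true_eq] at hik hj ⊢
    have hij' := Fin.lt_def.1 hij
    have hjk' := Fin.lt_def.1 hjk
    obtain ⟨z, hjz, hz⟩ := hj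
    rcases z with iz | jz <;> simp only [updWall] at hz
    · -- an old wall contact `iz`, at level `2 iz + c % 2`
      rcases lt_or_ge (colLv m c (Sum.inl iz)) (colLv m c (Sum.inr i)) with hlt | hge
      · exact hR.trans (hR.symm (nc hlt (by simp only [colLv]; omega) (by simp only [colLv]; omega)
          (hR.symm hjz) hik)) (hR.symm hjz)
      rcases lt_or_ge (colLv m c (Sum.inr k)) (colLv m c (Sum.inl iz)) with hlt' | hge'
      · exact nc (by simp only [colLv]; omega) (by simp only [colLv]; omega) hlt' hik hjz
      · have h1 : colLv m c (Sum.inr i) < colLv m c (Sum.inl iz) := by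
          refine lt_of_le_of_ne hge fun h => ?_
          simp only [colLv] at h
          omega
        have h2 : colLv m c (Sum.inl iz) < colLv m c (Sum.inr k) := by
          refine lt_of_le_of_ne hge' fun h => ?_
          simp only [colLv] at h
          omega
        exact hR.trans (hWN _ _ _ h1 h2 hik hz) (hR.symm hjz)
    · -- the new column's own wall site `jz = 0`
      obtain ⟨hc1, hjz0⟩ := hz
      by_cases hi0 : (i : ℕ) = 0
      · have : jz = i := Fin.ext (by omega)
        subst this
        exact hR.symm hjz
      · exact hR.trans (hR.symm (nc (p := Sum.inr jz) (by simp only [colLv]; omega)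
          (by simp only [colLv]; omega) (by simp only [colLv]; omega) (hR.symm hjz) hik)) (hR.symm hjz)

/-- The bare-column pattern is planar. [folklore] -/
theorem colInit_isPlanar (a : ℤ) : IsPlanar (colInit m a) := by
  refine ⟨fun i j k l hij hjk _ hik _ => ?_, fun i j k hij hjk hik _ => ?_⟩ <;>
    simp only [colInit, decide_eq_true_eq] at hik ⊢ <;> subst hik <;> exact absurd (hij.trans hjk) (lt_irrefl _)

/-- For a lattice edge function, the iterated patterns are planar. [folklore] -/
theorem colIter_isPlanar (a : ℤ) {E : ℤ → Fin (m + 1) → Fin (m + 1) → Bool}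
    (hE : ∀ c i j, E c i j = true → (zdGraph 2).Adj (colSite c i) (colSite (c + 1) j)) :
    ∀ n : ℕ, IsPlanar (colIter m a E n)
  | 0 => colInit_isPlanar a
  | n + 1 => colUpdate_isPlanar (colIter_isValid a E n) (colIter_isPlanar a hE n) (hE _)

/-- The edge layers of a lattice configuration are lattice edge functions. [folklore] -/
theorem adj_of_colEdges {ω : BondConfig (Site 2)} (hω : ω ⊆ (zdGraph 2).edgeSet) (c : ℤ)
    (i j : Fin (m + 1)) (h : colEdges ω m c i j = true) :
    (zdGraph 2).Adj (colSite c i) (colSite (c + 1) j) := by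
  classical
  simp only [colEdges, decide_eq_true_eq] at h
  exact hω h

/-- The edge function of a set of lattice edges of the layer is a lattice edge function. [folklore] -/
theorem adj_of_edgeFn (c : ℤ) {U : Finset (Sym2 (Site 2))} (hU : U ⊆ latticeLayer m c)
    (i j : Fin (m + 1)) (h : edgeFn m c U i j = true) :
    (zdGraph 2).Adj (colSite c i) (colSite (c + 1) j) := by
  classical
  simp only [edgeFn, decide_eq_true_eq] at h
  exact latticeLayer_subset_edgeSet c (hU h)

open MeasureTheory

/-- **The transfer matrix preserves planarity**: from a valid planar pattern, `T_c(P, P') = 0`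
unless `P'` is planar. [cite: IkhlefPonsaing2012, §3.1] -/
theorem ipTransfer_eq_zero_of_not_isPlanar (c : ℤ) {P P' : ColPattern m} (hP : IsValid c P)
    (hPl : IsPlanar P) (h : ¬ IsPlanar P') : ipTransfer m c P P' = 0 := by
  rw [ipTransfer_eq_sum']
  refine Finset.sum_eq_zero fun U hU => ?_
  rw [if_neg]
  rintro rfl
  exact h (colUpdate_isPlanar hP hPl (adj_of_edgeFn c (Finset.mem_powerset.1 hU)))

/-- The iterated laws are supported on planar patterns. [folklore] -/
theorem iterLaw_eq_zero_of_not_isPlanar (a : ℤ) (n : ℕ) {P : ColPattern m} (h : ¬ IsPlanar P) :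
    iterLaw m a n P = 0 := by
  unfold iterLaw
  rw [DCT16.real_congr_of_forall_subset_edgeSet (zdGraph 2) half (B := ∅) fun ω hω => ?_,
    measureReal_empty]
  simp only [Set.mem_setOf_eq, Set.mem_empty_iff_false, iff_false]
  rintro rfl
  exact h (colIter_isPlanar a (fun c i j h => adj_of_colEdges hω c i j h) n)

/-- **The stationary law is supported on planar patterns** (with `ipStationary_eq_zero_of_not_isValid`:
on valid planar even-column patterns — `binom(2m+1, m)` of them, lumping to the `C_{m+1}` link
patterns of IP12). [cite: IkhlefPonsaing2012, §3.1] -/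
theorem ipStationary_eq_zero_of_not_isPlanar {P : ColPattern m} (h : ¬ IsPlanar P) :
    ipStationary m P = 0 := by
  refine tendsto_nhds_unique (tendsto_lawAt0_apply P) ?_
  have : (fun M => lawAt0 m M P) = fun _ => 0 := by
    funext M
    exact iterLaw_eq_zero_of_not_isPlanar _ _ h
  rw [this]
  exact tendsto_const_nhds

end Planar

end Literature.Probability.Percolation
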